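import Literature.AnabelianGeometry.AbsoluteAnabelian.AbsTopIII.RemarksReconstruction
import HarnessLib

/-!
# [AbsTopIII] Rmk 1.10.1 (i)/(iii) — NON-VACUITY of `AbsTopIII.IndexedInvariants` WITH its compatibility law:
# the INDEX MODEL (row «NV-L4/AbsTopIII.IndexedInvariants»)

Mochizuki, *Topics in Absolute Anabelian Geometry III*, Rmk 1.10.1 (i)/(iii) p. 44 ("functorial … relative to
dividing the usual functorially induced morphism `H²(H₁, μ_Ẑ(H₁)) → H²(H₂, μ_Ẑ(H₂))` by … the index
`[H₁ : H₂]`"); typed by abc-iut-L4 in `AbsTopIII/RemarksReconstruction.lean` as `IndexedInvariants G R`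
(`obj`, `res`, `inv`) with the predicate `IsCompatible I factor` and the printed factor `galoisFactor H₁ H₂ := [H₁ : H₂]`.
PROOF-ONLY companion (no `def`, no `instance`, no `structure`). abc-iut-w5-d197's INHABITATION CENSUS L4 v1 (§A)
lists `IndexedInvariants` with ZERO producers. This file records the INDEX MODEL:

* `IndexedInvariants.exists_indexModel` — for EVERY group `G` and abelian group `R`: `obj H := R` for all `H`,
  `res (H₂ ≤ H₁) := multiplication by [H₁ : H₂]`, `inv H := id`; functoriality of `res` = `[H : H] = 1`
  (`Subgroup.relIndex_self`) and the tower law (the landed `galoisFactor_mul`); and the printed compatibility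
  `IsCompatible galoisFactor` HOLDS ON THE NOSE (`inv ∘ res = [H₁:H₂] • inv`, by `rfl`).
  GENUINE in the following precise sense: this is exactly the behaviour of restriction on `H²(H, μ_Ẑ(H)) ≅ Ẑ`
  under the invariant maps of local class field theory (restriction to an open subgroup of index `n` multiplies
  the invariant by `n`) — the law Rmk 1.10.1 (iii) is about; the IDENTIFICATION of the model's `obj H` with actual
  Galois cohomology is LCFT (campaign-L) and is NOT claimed here.
* `exists_isCompatible_galoisFactor` — the compatibility predicate is satisfiable over every `(G, R)`;
  `exists_indexModel_int` — closed-universe instance `R := ℤ` (the `Ẑ` of print would be `R := ℤ_p`-adic/profinite;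
  any `R` works).

Nothing of [AbsTopIII] is asserted; a witness is consistency evidence only.
[cite: MochizukiAbsTopIII2015, Rmk 1.10.1 (iii) p.44]
-/

namespace Literature.AnabelianGeometry.AbsoluteAnabelian.AbsTopIII

namespace IndexedInvariants

universe u v

variable (G : Type u) [Group G] (R : Type v) [AddCommGroup R]

/-- **AbsTopIII:Rmk1.10.1(iii)** (kurims p.44) THE INDEX MODEL: `obj H := R`, `res := [H₁ : H₂] • (·)`, `inv := id`
is an `IndexedInvariants G R` satisfying the printed compatibility `IsCompatible galoisFactor` — for every group
`G` and abelian group `R`. (Restriction on `H²(·, μ_Ẑ) ≅ Ẑ` multiplies invariants by the index; the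
identification with actual cohomology is LCFT and not claimed.) [cite: MochizukiAbsTopIII2015, Rmk 1.10.1 (iii) p.44] -/
theorem exists_indexModel :
    ∃ I : IndexedInvariants G R, I.IsCompatible galoisFactor ∧ (∀ H, I.obj H = R) := by
  refine ⟨{ obj := fun _ => R
            res := fun {H₁ H₂} _ => DistribSMul.toAddMonoidHom R (galoisFactor H₁ H₂)
            res_refl := fun H x => ?_
            res_trans := fun {H₁ H₂ H₃} h₁₂ h₂₃ x => ?_
            inv := fun _ => AddMonoidHom.id R }, ?_, fun _ => rfl⟩
  · -- `[H : H] • x = x`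
    show (galoisFactor H H) • x = x
    rw [galoisFactor, Subgroup.relIndex_self, one_smul]
  · -- tower law `[H₂:H₃]·[H₁:H₂] = [H₁:H₃]`
    show galoisFactor H₂ H₃ • galoisFactor H₁ H₂ • x = galoisFactor H₁ H₃ • x
    rw [smul_smul, galoisFactor_mul h₁₂ h₂₃]
  · -- compatibility `inv (res x) = [H₁:H₂] • inv x`, on the nose
    intro H₁ H₂ h x
    rfl

/-- **AbsTopIII:Rmk1.10.1(iii)** (kurims p.44) The compatibility predicate `IsCompatible galoisFactor` is satisfiable
over every `(G, R)`. [cite: MochizukiAbsTopIII2015, Rmk 1.10.1 (iii) p.44] -/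
theorem exists_isCompatible_galoisFactor : ∃ I : IndexedInvariants G R, I.IsCompatible galoisFactor :=
  let ⟨I, hI, _⟩ := exists_indexModel G R; ⟨I, hI⟩

/-- **AbsTopIII:Rmk1.10.1(iii)** (kurims p.44) The interface is inhabited over every `(G, R)`.
[cite: MochizukiAbsTopIII2015, Rmk 1.10.1 (iii) p.44] -/
theorem nonempty_model : Nonempty (IndexedInvariants G R) :=
  let ⟨I, _⟩ := exists_isCompatible_galoisFactor G R; ⟨I⟩

/-- **AbsTopIII:Rmk1.10.1(iii)** (kurims p.44) Closed instance: the index model with values in `ℤ` over any group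
(e.g. the absolute Galois group of an MLF). [cite: MochizukiAbsTopIII2015, Rmk 1.10.1 (iii) p.44] -/
theorem exists_indexModel_int : ∃ I : IndexedInvariants G ℤ, I.IsCompatible galoisFactor ∧ ∀ H, I.obj H = ℤ :=
  exists_indexModel G ℤ

/-- **AbsTopIII:Rmk1.10.1(ii)** (kurims p.44) In the index model the landed consequence `IsCompatible.eq_of_res`
reads: the identification at `H` of a class restricted from the whole group is `[G : H]` times the
identification at the top — instantiated (non-vacuity of that theorem's hypothesis).
[cite: MochizukiAbsTopIII2015, Rmk 1.10.1 (ii) p.44] -/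
theorem exists_eq_of_res :
    ∃ I : IndexedInvariants G R, ∀ (H : Subgroup G) (x : I.obj ⊤),
      I.inv H (I.res le_top x) = galoisFactor ⊤ H • I.inv ⊤ x :=
  let ⟨I, hI, _⟩ := exists_indexModel G R; ⟨I, fun H x => hI.eq_of_res H x⟩

end IndexedInvariants

end Literature.AnabelianGeometry.AbsoluteAnabelian.AbsTopIII
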